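import Summits.AnomalousDissipation.AnomalousDissipation.Theorems.EnsembleRigidityDefs
import Summits.AnomalousDissipation.AnomalousDissipation.Theorems.EnsembleRigidityResidualTransferSSSTestEnstrophyTame
import Literature.Analysis.FluidPDE.CylindricalGenerator
import Literature.Analysis.FluidPDE.StatisticalSolutionProofs
import Literature.Analysis.FluidPDE.SeisSliceIncrement
import Literature.Analysis.FluidPDE.NSStrongSolutions2D
import HarnessLib

/-!
# Stub `stub_desaturation` of line `Sketch` (crux stmt-AnomalousDissipation-15508,
  `EnsembleRigidity.GPStatisticalRigidity`)

**Time-reversal normal form: the shell-work clause of the crux is idle.** For a force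
`f ∈ L²(T³)` and constants `(E, c, δ₀)`, if the rigidity conclusion `c ≤ R √G` holds for every
admissible probability measure `μ` on `H = L²_σ(T³)` (integrable energy, mean energy `≤ E`,
finite mean enstrophy `G`, cylindrical forced-Euler defect `≤ R ≤ δ₀`) WITH non-negative work
`∫_{e₁ ≤ |v|² < e₂} (v, f) dμ ≥ 0` on every energy shell, then it holds WITHOUT the shell
hypothesis.

Proof. `T : v ↦ −v` is an isometric involution of `H`; average `μ` with its push-forward,
`μ̃ := ½ (μ + T_* μ)`. Energy, integrability and enstrophy are `T`-invariant (`‖−v‖ = ‖v‖`,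
`‖∇(−v)‖² = ‖∇v‖²` through the a.e. class, `eGradNormSq_congr_ae`, `eGradNormSq_neg`), the
work `(v, f)` is odd and every shell is symmetric, so `μ̃` has ZERO shell work. For the defect:
with the reflected functional `TΦ` (`φ ↦ φ ∘ Neg.neg`, same test fields) one has
`(TΦ)'(v) = −Φ'(−v)`, `⟨F₀(−v), w⟩ = ⟨F₀(v), w⟩` (the inertial term is quadratic),
`⟨F₀(v), −w⟩ = −⟨F₀(v), w⟩` and `‖∇(−w)‖² = ‖∇w‖²`; hence
`∫ ⟨F₀, Φ'⟩ dT_*μ = −∫ ⟨F₀, (TΦ)'⟩ dμ` and `∫ ‖∇Φ'‖² dT_*μ = ∫ ‖∇(TΦ)'‖² dμ` (the test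
enstrophy `v ↦ ‖∇Φ'(v)‖²` is bounded continuous, `ResidualTransferSSS.stub_testEnstrophyTame`,
so these are honest integrals), and the power-mean inequality `(x + y)/2 ≤ √((x² + y²)/2)`
gives the defect bound for `μ̃` at the same `R`. The hypothesis applied to `μ̃` is the
conclusion for `μ`, the enstrophies being equal.

## References

* C. Foias, O. Manley, R. Rosa, R. Temam, *Navier–Stokes Equations and Turbulence* (CUP 2001),
  Ch. IV §1.2 Def. 1.3, (1.29)–(1.31). [FoiasManleyRosaTemam2001]
-/

set_option linter.dupNamespace false

noncomputable section

namespace Summit.AnomalousDissipation.AnomalousDissipation.Theorems.EnsembleRigidity.GPStatisticalRigidity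

open MeasureTheory Filter Topology UnitAddTorus
open scoped InnerProductSpace RealInnerProductSpace ENNReal NNReal
open Literature.Analysis.FunctionSpaces Literature.Analysis.FluidPDE
open Summit.AnomalousDissipation.AnomalousDissipation.Theorems.EnsembleRigidity

/-- Local notation: real vector fields on `T³`. -/
local notation "Vec3" => (UnitAddTorus (Fin 3)) → (EuclideanSpace ℝ (Fin 3))
/-- Local notation: `L²(T³; ℝ³)`. -/
local notation "L2" => (Lp (EuclideanSpace ℝ (Fin 3)) 2 (volume : Measure (UnitAddTorus (Fin 3))))
/-- Local notation: the energy space `H`. -/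
local notation "H3" => (Torus.energySpace (Fin 3))

/-! ### Negation on `H`: pairing, enstrophy, generator -/

/-- The work functional is odd: `(−v, g) = −(v, g)` for `g ∈ L²` (cf. `pairing_neg` of
`CubicParityLoud.Negative.LoadBearing`, a refuter file not imported here). [folklore] -/
private theorem desaturation_pairing_neg {g : Vec3} (hg : MemLp g 2 volume) (v : H3) :
    Torus.pairing (((-v : H3) : L2)) g = -Torus.pairing ((v : H3) : L2) g := by
  rw [Submodule.coe_neg, Torus.pairing_eq_inner hg, Torus.pairing_eq_inner hg, inner_neg_left]

/-- The enstrophy is even: `‖∇(−v)‖² = ‖∇v‖²` on `H` (through the a.e. class of the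
representative). [folklore] -/
theorem desaturation_eGradNormSq_neg (v : H3) :
    Torus.eGradNormSq (((-v : H3) : L2) : Vec3) = Torus.eGradNormSq (((v : H3) : L2) : Vec3) := by
  rw [Submodule.coe_neg, eGradNormSq_congr_ae (Lp.coeFn_neg _)]
  exact eGradNormSq_neg _

/-- `D(−w) = −Dw` on the torus (no differentiability needed; cf. `fderiv_neg_slice` of
`OnsagerBDSVTransportEstimates`, not imported here). [folklore] -/
private theorem desaturation_fderiv_neg (w : Vec3) (x : UnitAddTorus (Fin 3)) :
    Torus.fderiv (fun y => -w y) x = -Torus.fderiv w x := by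
  unfold Torus.fderiv
  rw [show Torus.liftAt (fun y => -w y) x = fun v => -(Torus.liftAt w x v) from rfl]
  exact _root_.fderiv_fun_neg

/-- The test enstrophy is even in the test field: `‖∇(−w)‖² = ‖∇w‖²`. [folklore] -/
theorem desaturation_gradNormSq_neg (w : Vec3) :
    Torus.gradNormSq (fun x => -w x) = Torus.gradNormSq w := by
  unfold Torus.gradNormSq
  simp_rw [Torus.partialDeriv_neg, norm_neg]

/-- The forced-Euler generator is odd in the test field: `⟨F₀(u), −w⟩ = −⟨F₀(u), w⟩`.
[folklore] -/
theorem desaturation_generator_neg_right (f : Vec3) (u : H3) (w : Vec3) :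
    Torus.nsGeneratorPairing 0 f u (fun x => -w x) = -Torus.nsGeneratorPairing 0 f u w := by
  unfold Torus.nsGeneratorPairing Torus.inertialPairing
  simp only [zero_mul, add_zero, desaturation_fderiv_neg, neg_apply, inner_neg_right,
    inner_neg_left, integral_neg, neg_add]

/-- The forced-Euler generator is even in the state: `⟨F₀(−u), w⟩ = ⟨F₀(u), w⟩` (the inertial
term is quadratic in `u`). [folklore] -/
theorem desaturation_generator_neg_left (f : Vec3) (u : H3) (w : Vec3) :
    Torus.nsGeneratorPairing 0 f (-u) w = Torus.nsGeneratorPairing 0 f u w := by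
  unfold Torus.nsGeneratorPairing Torus.inertialPairing
  simp only [zero_mul, add_zero, Submodule.coe_neg]
  congr 1
  refine integral_congr_ae ?_
  filter_upwards [Lp.coeFn_neg ((u : H3) : L2)] with x hx
  rw [hx, Pi.neg_apply, map_neg, inner_neg_neg]

/-! ### The reflected cylindrical test functional `TΦ = Φ ∘ (v ↦ −v)` -/

/-- The chain rule through `y ↦ −y` for a `C¹` profile: `D(φ ∘ neg)(y) e = −Dφ(−y) e`.
[folklore] -/
theorem desaturation_fderiv_comp_neg {n : ℕ} {φ : EuclideanSpace ℝ (Fin n) → ℝ}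
    (hφ : ContDiff ℝ 1 φ) (y e : EuclideanSpace ℝ (Fin n)) :
    fderiv ℝ (fun z => φ (-z)) y e = -fderiv ℝ φ (-y) e := by
  have h :=
    ((hφ.differentiable one_ne_zero (-y)).hasFDerivAt.comp y (hasFDerivAt_id y).neg).fderiv
  simp only [Function.comp_def] at h
  rw [h]
  simp

/-- **The reflected test functional.** For every cylindrical `Φ` there is a cylindrical `TΦ`
(the same test fields, profile `φ ∘ Neg.neg`, so `(TΦ)(u) = Φ(−u)`) with `(TΦ)'(v) = −Φ'(−v)`
on `T³`. [folklore] -/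
theorem desaturation_exists_reflect (Φ : Torus.CylindricalTest (Fin 3)) :
    ∃ Ψ : Torus.CylindricalTest (Fin 3), ∀ v : H3, Ψ.grad v = fun x => -Φ.grad (-v) x := by
  refine ⟨
    { m := Φ.m
      g := Φ.g
      g_smooth := Φ.g_smooth
      g_divFree := Φ.g_divFree
      g_zeroMean := Φ.g_zeroMean
      φ := fun y => Φ.φ (-y)
      φ_contDiff := Φ.φ_contDiff.comp contDiff_neg
      φ_compact := Φ.φ_compact.comp_homeomorph (Homeomorph.neg _) }, fun v => ?_⟩
  have hc : Φ.coords (-v) = -Φ.coords v := by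
    unfold Torus.CylindricalTest.coords
    rw [← WithLp.toLp_neg]
    congr 1
    funext i
    rw [Pi.neg_apply]
    exact desaturation_pairing_neg ((Φ.g_smooth i).memLp 2) v
  funext x
  show (∑ i : Fin Φ.m,
      fderiv ℝ (fun y => Φ.φ (-y)) (Φ.coords v) (EuclideanSpace.single i 1) • Φ.g i x) =
    -(∑ i : Fin Φ.m, fderiv ℝ Φ.φ (Φ.coords (-v)) (EuclideanSpace.single i 1) • Φ.g i x)
  rw [← Finset.sum_neg_distrib]
  refine Finset.sum_congr rfl fun i _ => ?_
  rw [desaturation_fderiv_comp_neg Φ.φ_contDiff, hc, neg_smul]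

/-- The test enstrophy `v ↦ ‖∇Θ'(v)‖²` is integrable against every finite measure on `H`
(bounded and continuous, `ResidualTransferSSS.stub_testEnstrophyTame`). [folklore] -/
theorem desaturation_integrable_testEnstrophy (Θ : Torus.CylindricalTest (Fin 3))
    (μ : Measure H3) [IsFiniteMeasure μ] :
    Integrable (fun v : H3 => Torus.gradNormSq (Θ.grad v)) μ := by
  obtain ⟨hc, C, hC⟩ := ResidualTransferSSS.stub_testEnstrophyTame Θ
  refine Integrable.mono' (integrable_const C) hc.aestronglyMeasurable (ae_of_all _ fun v => ?_)
  rw [Real.norm_eq_abs, abs_of_nonneg (Torus.gradNormSq_nonneg _)]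
  exact hC v

/-- The power-mean step: `|a| ≤ R x`, `|b| ≤ R y` give `|½(a − b)| ≤ R √(½(x² + y²))`.
[folklore] -/
theorem desaturation_powerMean {R a b X Y : ℝ} (hR : 0 ≤ R) (hX : 0 ≤ X) (hY : 0 ≤ Y)
    (ha : |a| ≤ R * Real.sqrt X) (hb : |b| ≤ R * Real.sqrt Y) :
    |2⁻¹ * (a + -b)| ≤ R * Real.sqrt (2⁻¹ * (X + Y)) := by
  have hx := Real.sq_sqrt hX
  have hy := Real.sq_sqrt hY
  have hsx := Real.sqrt_nonneg X
  have hsy := Real.sqrt_nonneg Y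
  have hmean : 2⁻¹ * (Real.sqrt X + Real.sqrt Y) ≤ Real.sqrt (2⁻¹ * (X + Y)) := by
    rw [show 2⁻¹ * (Real.sqrt X + Real.sqrt Y) =
        Real.sqrt ((2⁻¹ * (Real.sqrt X + Real.sqrt Y)) ^ 2)
      from (Real.sqrt_sq (by positivity)).symm]
    refine Real.sqrt_le_sqrt ?_
    nlinarith [sq_nonneg (Real.sqrt X - Real.sqrt Y)]
  calc |2⁻¹ * (a + -b)| = 2⁻¹ * |a - b| := by
        rw [abs_mul, abs_of_pos (by norm_num : (0 : ℝ) < 2⁻¹), ← sub_eq_add_neg]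
    _ ≤ 2⁻¹ * (R * Real.sqrt X + R * Real.sqrt Y) := by
        gcongr
        exact (abs_sub _ _).trans (add_le_add ha hb)
    _ = R * (2⁻¹ * (Real.sqrt X + Real.sqrt Y)) := by ring
    _ ≤ R * Real.sqrt (2⁻¹ * (X + Y)) := mul_le_mul_of_nonneg_left hmean hR

/-! ### The stub -/

/-- **D `stub_desaturation`** (SIDE STUB — normal form, idea `time-reversal-desaturation`) — THE SHELL
CLAUSE IS IDLE. For `f ∈ L²` and constants `(E, c, δ₀)`: if the rigidity conclusion holds for all
admissible `μ` WITH non-negative work on every energy shell, it holds for all admissible `μ` (no shell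
hypothesis). Proof: `T : v ↦ −v` preserves `H`, energy, enstrophy, integrability and the defect
clause at the same `R` (with `(TΦ).φ := Φ.φ ∘ Neg.neg`: `(TΦ)'(v) = −Φ'(−v)`,
`⟨F₀(−v), w⟩ = ⟨F₀(v), w⟩`, `⟨F₀(v), −w⟩ = −⟨F₀(v), w⟩`) and reverses the work on every shell;
the average `½(μ + T_*μ)` is admissible with the same `(R, G)` (`(√a + √b)/2 ≤ √((a+b)/2)`) and
zero shell work. [folklore] -/
theorem stub_desaturation (f : Vec3) (hf : MemLp f 2 volume) (E c δ₀ : ℝ)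
    (h : ∀ μ : Measure H3, IsProbabilityMeasure μ →
      Integrable (fun v : H3 => ‖v‖ ^ 2) μ → Torus.ensembleEnergy μ ≤ E → Torus.ensembleEnstrophy μ < ⊤ →
      (∀ e₁ e₂ : ℝ≥0∞, e₁ < e₂ →
        0 ≤ ∫ v in {v : H3 | e₁ ≤ ‖v‖ₑ ^ 2 ∧ ‖v‖ₑ ^ 2 < e₂}, Torus.pairing (v : L2) f ∂μ) →
      ∀ R : ℝ, 0 ≤ R → R ≤ δ₀ →
        (∀ Φ : Torus.CylindricalTest (Fin 3),
          Integrable (fun v : H3 => Torus.nsGeneratorPairing 0 f v (Φ.grad v)) μ ∧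
            |∫ v, Torus.nsGeneratorPairing 0 f v (Φ.grad v) ∂μ| ≤
              R * Real.sqrt (∫ v, Torus.gradNormSq (Φ.grad v) ∂μ)) →
        c ≤ R * Real.sqrt (Torus.ensembleEnstrophy μ).toReal) :
    ∀ μ : Measure H3, IsProbabilityMeasure μ →
      Integrable (fun v : H3 => ‖v‖ ^ 2) μ → Torus.ensembleEnergy μ ≤ E → Torus.ensembleEnstrophy μ < ⊤ →
      ∀ R : ℝ, 0 ≤ R → R ≤ δ₀ →
        (∀ Φ : Torus.CylindricalTest (Fin 3),
          Integrable (fun v : H3 => Torus.nsGeneratorPairing 0 f v (Φ.grad v)) μ ∧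
            |∫ v, Torus.nsGeneratorPairing 0 f v (Φ.grad v) ∂μ| ≤
              R * Real.sqrt (∫ v, Torus.gradNormSq (Φ.grad v) ∂μ)) →
        c ≤ R * Real.sqrt (Torus.ensembleEnstrophy μ).toReal := by
  intro μ hμ hint hE hG R hR0 hRδ hdef
  haveI := hμ
  -- the reflection `T` and the push-forward `ν = T_* μ`
  have hTa : ∀ v : H3, MeasurableEquiv.neg H3 v = -v := fun v => by simp
  set ν : Measure H3 := μ.map (MeasurableEquiv.neg H3) with hν
  haveI : IsProbabilityMeasure ν :=
    Measure.isProbabilityMeasure_map (MeasurableEquiv.neg H3).measurable.aemeasurable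
  have hIν : ∀ g : H3 → ℝ, ∫ v, g v ∂ν = ∫ v, g (-v) ∂μ := fun g => by
    rw [hν, integral_map_equiv]
    simp only [hTa]
  have hIntν : ∀ g : H3 → ℝ, Integrable (fun v => g (-v)) μ → Integrable g ν := fun g hg => by
    rw [hν]
    refine (integrable_map_equiv _ g).2 ?_
    simpa only [Function.comp_def, hTa] using hg
  -- the symmetrised measure `μ' = ½ (μ + ν)`
  set μ' : Measure H3 := (2⁻¹ : ℝ≥0∞) • (μ + ν) with hμ'
  have h2 : (2⁻¹ : ℝ≥0∞) * 2 = 1 := ENNReal.inv_mul_cancel two_ne_zero ENNReal.ofNat_ne_top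
  have hprob : IsProbabilityMeasure μ' := ⟨by
    rw [hμ', Measure.smul_apply, Measure.add_apply, measure_univ, measure_univ, smul_eq_mul,
      one_add_one_eq_two, h2]⟩
  have hInt' : ∀ g : H3 → ℝ, Integrable g μ → Integrable g ν → Integrable g μ' :=
    fun g h1 h2 => by
    rw [hμ']
    exact (h1.add_measure h2).smul_measure (ENNReal.inv_ne_top.2 two_ne_zero)
  have hI : ∀ g : H3 → ℝ, Integrable g μ → Integrable g ν →
      ∫ v, g v ∂μ' = 2⁻¹ * ((∫ v, g v ∂μ) + ∫ v, g (-v) ∂μ) := fun g hgμ hgν => by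
    rw [hμ', integral_smul_measure, integral_add_measure hgμ hgν, hIν, smul_eq_mul,
      ENNReal.toReal_inv, ENNReal.toReal_ofNat]
  -- energy
  have hintν : Integrable (fun v : H3 => ‖v‖ ^ 2) ν :=
    hIntν _ (by simpa only [norm_neg] using hint)
  have hint' : Integrable (fun v : H3 => ‖v‖ ^ 2) μ' := hInt' _ hint hintν
  have hE' : Torus.ensembleEnergy μ' ≤ E := by
    have h1 : Torus.ensembleEnergy μ' = Torus.ensembleEnergy μ := by
      unfold Torus.ensembleEnergy
      rw [hI _ hint hintν]
      simp only [norm_neg]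
      ring
    exact h1 ▸ hE
  -- enstrophy
  have hGeq : Torus.ensembleEnstrophy μ' = Torus.ensembleEnstrophy μ := by
    unfold Torus.ensembleEnstrophy
    rw [hμ', lintegral_smul_measure, lintegral_add_measure, hν, lintegral_map_equiv]
    simp only [hTa, desaturation_eGradNormSq_neg, smul_eq_mul]
    rw [← two_mul, ← mul_assoc, h2, one_mul]
  have hG' : Torus.ensembleEnstrophy μ' < ⊤ := hGeq ▸ hG
  -- zero shell work
  have hP : Integrable (fun v : H3 => Torus.pairing (v : L2) f) μ := by
    refine Integrable.mono' ((hint.add (integrable_const 1)).const_mul ‖hf.toLp f‖)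
      (Torus.continuous_pairing_coe hf).aestronglyMeasurable (ae_of_all _ fun v => ?_)
    rw [Real.norm_eq_abs]
    refine (Torus.abs_pairing_coe_le hf v).trans ?_
    simp only [Pi.add_apply]
    nlinarith [mul_nonneg (norm_nonneg (hf.toLp f)) (sq_nonneg (‖v‖ - 1)),
      mul_nonneg (norm_nonneg (hf.toLp f)) (norm_nonneg v)]
  have hPν : Integrable (fun v : H3 => Torus.pairing (v : L2) f) ν :=
    hIntν _ (by simpa only [desaturation_pairing_neg hf] using hP.fun_neg)
  have hshell : ∀ e₁ e₂ : ℝ≥0∞, e₁ < e₂ →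
      0 ≤ ∫ v in {v : H3 | e₁ ≤ ‖v‖ₑ ^ 2 ∧ ‖v‖ₑ ^ 2 < e₂}, Torus.pairing (v : L2) f ∂μ' := by
    intro e₁ e₂ _
    have hpre : (MeasurableEquiv.neg H3) ⁻¹' {v : H3 | e₁ ≤ ‖v‖ₑ ^ 2 ∧ ‖v‖ₑ ^ 2 < e₂} =
        {v : H3 | e₁ ≤ ‖v‖ₑ ^ 2 ∧ ‖v‖ₑ ^ 2 < e₂} := by
      ext v
      simp only [Set.mem_preimage, Set.mem_setOf_eq, hTa, enorm_neg]
    rw [hμ', Measure.restrict_smul, Measure.restrict_add, integral_smul_measure,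
      integral_add_measure hP.restrict hPν.restrict, hν, setIntegral_map_equiv, hpre]
    simp only [hTa, desaturation_pairing_neg hf, integral_neg, add_neg_cancel, smul_zero,
      le_refl]
  -- the defect clause at the same `R`
  have hdef' : ∀ Φ : Torus.CylindricalTest (Fin 3),
      Integrable (fun v : H3 => Torus.nsGeneratorPairing 0 f v (Φ.grad v)) μ' ∧
        |∫ v, Torus.nsGeneratorPairing 0 f v (Φ.grad v) ∂μ'| ≤
          R * Real.sqrt (∫ v, Torus.gradNormSq (Φ.grad v) ∂μ') := by
    intro Φ
    obtain ⟨Ψ, hΨ⟩ := desaturation_exists_reflect Φ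
    have hgen : ∀ v : H3, Torus.nsGeneratorPairing 0 f (-v) (Φ.grad (-v)) =
        -Torus.nsGeneratorPairing 0 f v (Ψ.grad v) := fun v => by
      rw [hΨ, desaturation_generator_neg_right, neg_neg, desaturation_generator_neg_left]
    have hens : ∀ v : H3, Torus.gradNormSq (Φ.grad (-v)) = Torus.gradNormSq (Ψ.grad v) :=
      fun v => by rw [hΨ, desaturation_gradNormSq_neg]
    obtain ⟨hLμ, hbd⟩ := hdef Φ
    obtain ⟨hLΨ, hbdΨ⟩ := hdef Ψ
    have hLν : Integrable (fun v : H3 => Torus.nsGeneratorPairing 0 f v (Φ.grad v)) ν := by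
      refine hIntν _ ?_
      simp_rw [hgen]
      exact hLΨ.fun_neg
    have hNμ := desaturation_integrable_testEnstrophy Φ μ
    have hNν : Integrable (fun v : H3 => Torus.gradNormSq (Φ.grad v)) ν := by
      refine hIntν _ ?_
      simp_rw [hens]
      exact desaturation_integrable_testEnstrophy Ψ μ
    refine ⟨hInt' _ hLμ hLν, ?_⟩
    rw [hI _ hLμ hLν, hI _ hNμ hNν]
    simp_rw [hgen, hens, integral_neg]
    exact desaturation_powerMean hR0 (integral_nonneg fun v => Torus.gradNormSq_nonneg _)
      (integral_nonneg fun v => Torus.gradNormSq_nonneg _) hbd hbdΨ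
  -- conclude with the hypothesis at `μ'`, whose enstrophy is that of `μ`
  have hc := h μ' hprob hint' hE' hG' hshell R hR0 hRδ hdef'
  rwa [hGeq] at hc

end Summit.AnomalousDissipation.AnomalousDissipation.Theorems.EnsembleRigidity.GPStatisticalRigidity

end
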